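import Literature.NumberTheory.ComplexMultiplication.CosetGermAlmostCartesianSquare
import Literature.AlgebraicGeometry.Deligne1982.CMTypeRelationLattice
import HarnessLib

/-!
# Milne 1999 §6 p. 71 LEMMA 6.10 in the group ring: the square `⊕_{Φ∈I} X^*(T^Φ) → X^*(S^K)` over `⊕_{Π∈I′} X^*(L^Π) → X^*(P^K)` is almost
# cartesian, `I = Γ\{CM-types on K}`, `I′ = Γ\W^K_{1,+}(p^∞)`; with the two transfer lemmas behind «obvious from the previous lemma» and
# «which implies that Ker(α′) → Ker(α) is surjective» (J. S. Milne, *Lefschetz motives and the Tate conjecture*, Compositio Math. 117 (1999), §6 pp. 71–72)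

Family `hodge`, lane `lit-hodgefound` (Layer A3; seat `lit-hodgefound-p27`, generation 17, row g17-#4); topic
`Literature/NumberTheory/ComplexMultiplication`, namespace `Literature.NumberTheory.ComplexMultiplication.CosetGerm` (§0 in `….AlmostCartesian`).
`CMTypes h` is a type synonym of the lane's `Literature.AlgebraicGeometry.Deligne1982.CMTypesFor (ι·)` (CM types for a self-map of a finite set;
`Deligne1982/CMTypeRelationLattice.lean`), indexed by the `Setting` so that the translation action is an instance.
Direct sequel of g17-#3 `CosetGermAlmostCartesianSquare` (the model: `serreLattice = X^*(S^K) ⊂ R[Γ]`, `alphaS`/`weilLattice`/`alphaP = X^*(α)`,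
`psi`/`psiBar`, `eq_sum_psi_add_psiBar`, `alphaS_eq_zero_iff`) and of g16-#8 `AlmostCartesianSquares` (`IsAlmostCartesian`).  GROUP-RING ALGEBRA ONLY
for the abstract `Setting ι Γ₀ D` of g17-#2 (`Γ = Γ₀ × ⟨ι⟩ ⊇ Γ₀ ⊇ D`) with coefficients `R` without zero divisors, `2 ≠ 0`, `d = |D| ≠ 0` in `R`
(Milne: `ℤ`).  Definitions with bodies + THEOREMS; no named fact (D-0026, net debt 0).

THE PRINT.  [Milne1999] §6 p. 71 L15 – p. 72 L4 (held `paper:doi-10-1023-a-1000776613765` p0027–p0028), verbatim: «Let `I = Γ\{CM-types on K}` and let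
`I′ = Γ\W^K_{1,+}(p^∞)`.  LEMMA 6.10. The square `⊕_{Φ∈I} X^*(T^Φ) −γ→ X^*(S^K)` [over] `⊕_{Π∈I′} X^*(T^Π) −β→ X^*(P^K)` [verticals `α″`, `α`] is
almost Cartesian.  Proof. Since the maps are all surjective, it suffices to prove that the map `Ker(α″) → Ker(α)` is surjective, but this is
obvious from the previous lemma.  Consider the diagram: `⊕_{Φ∈I} X^*(T^Φ) → X^*(T^K) → X^*(S^K)` [over] `⊕_{Π∈I′} X^*(L^Π) → X^*(L^K) → X^*(P^K)`
[verticals `α″`, `α′`, `α`].  The last lemma shows that the composite of the maps `Ker(α″) → Ker(α′) → Ker(α)` is surjective, which implies that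
`Ker(α′) → Ker(α)` is surjective. Therefore the right hand square is almost Cartesian, which completes the proof of Theorem 6.1.»  (Earlier, p. 68:
«Completion of the proof of the Theorem 6.1. It suffices to prove that [`X^*(T^K) → X^*(S^K)` over `X^*(L^K) → X^*(P^K)`] is almost Cartesian
for all sufficiently large CM-fields `K ⊂ ℚ^{al}`».)

THE MODEL (continuing g17-#3's dictionary; `Hom(K, ℚ^{al}) = Γ`).
* «CM-types on `K`» = **`CMTypes h`** = the `Φ ⊂ Γ` with `x ∈ Φ ⟺ ιx ∉ Φ` (as `Finset`s; the type is indexed by the `Setting` `h` so that the left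
  translation `Φ ↦ gΦ` is a `MulAction` instance); `𝟙_Φ = ind Φ ∈ X^*(S^K)`; Milne's `ψ_τ = 𝟙_{τ·psiType}` (`psiType = {1} ∪ ι(Γ₀ ∖ {1})`),
  `ψ̄ = 𝟙_{barType}` (`barType = ιΓ₀`).  `I` = **`CMOrbits`** = `orbitRel.Quotient Γ (CMTypes h)`; for `c ∈ I`, `X^*(T^c) = CharModule R c.orbit ι` and `X^*(T^c) → X^*(S^K)`, `[δ_Φ] ↦ 𝟙_Φ`, is **`orbitToS`**
  (g15-#1 `liftChar`, as `𝟙_Φ + 𝟙_{ιΦ} = s^K`); `⊕_{Φ∈I} X^*(T^Φ)` = the finite product **`TSum`**, `γ = `**`tSumToS`**.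
* `W^K_{1,+}(p^∞)` = **`WeilGerms`** = `{push(𝟙_Φ) | Φ a CM type} ⊂ R[Γ/D]` (every element of `W^K_{1,+}(p^∞)` is a `π(Φ)`, §5; `π(Φ) ↦ f_{π(Φ)} =
  push(𝟙_Φ)` by Lemma 5.1's diagram), with `Γ` acting by translation; `π = `**`red`** `: CMTypes → WeilGerms` («the reduction functor» on generators);
  `I′` = **`WeilOrbits`**; for `c′ ∈ I′`, `X^*(L^{c′}) = CharModule R c′.orbit ι`, `X^*(L^{c′}) → X^*(P^K)`, `[δ_π] ↦ f_π`, is **`orbitToP`**;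
  `⊕_{Π∈I′} X^*(L^Π)` = **`LSum`**, `β = `**`lSumToP`** (into `weilLattice`).
* `α″ = `**`alphaSum`**: on the summand of `c ∈ I` it is the push `X^*(T^c) → X^*(L^{π(c)})` along `Φ ↦ π(Φ)` (g16-#6 `OrbitTorus.push`), placed in
  the summand `redOrbit c ∈ I′`.
* LEMMA 6.10 = **`isAlmostCartesian_sum`**, by §0's `IsAlmostCartesian.of_kernel_lift` (LEMMA 6.3 (c) as a constructor) fed with the lift of the
  proof of Lemma 6.9 (g17-#3's computation `alphaS_eq_zero_iff` + `eq_sum_psi_add_psiBar`): an `f ∈ Ker X^*(α)` is `Σ a_iψ_i` with vanishing block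
  sums, the image of `[Σ a_iδ_{τ_iΦ₀}]` in the `Ψ`-summand, which `α″` kills — this is the content of «obvious from the previous lemma».
* §0 also proves the second transfer, **`IsAlmostCartesian.of_quotients`**: an almost cartesian square stays almost cartesian after replacing
  `N″ ↠ T`, `M″ ↠ L` by compatible quotients — the mechanism of «which implies that `Ker(α′) → Ker(α)` is surjective. Therefore the right hand
  square is almost Cartesian»; its instance for `X^*(T^K)`, `X^*(L^K)` (amalgamation of the `t^Ψ`, `l^Π`) is the next row.

WHAT IS HERE (all PROVED): §0 **`IsAlmostCartesian.of_kernel_lift`**, **`IsAlmostCartesian.of_quotients`**; §1 DEF **`CMTypes`** (`ext`, `mem_iff`,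
`not_mem_iff`, `mem_image_mul_iff`, the `MulAction` by left translation: `coe_smul`, `mem_smul_iff`, `mem_iota_smul_iff`), DEF **`ind`** (`ind_apply`,
`act_ind`, `ind_add_ind_smul : 𝟙_Φ + 𝟙_{ιΦ} = s^K`, `ind_mem_serreLattice`), DEF `psiType` (`mem_psiType_iff`, `ind_psiType : 𝟙 = ψ_1`,
`ind_smul_psiType : 𝟙_{τ·psiType} = ψ_τ`), DEF `barType` (`ind_barType = ψ̄`), `CMOrbits` (`smul_mem_orbit`, `self_mem_orbit`), DEF **`orbitToS`**
(`orbitToS_mk_single`, `orbitToS_mem`), **`TSum`**, DEF **`tSumToS`** (`tSumToS_single`, `tSumToS_mem`), DEF `tSumToSs` (`coe_tSumToSs`,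
`tSumToS_single_sum`, **`tSumToSs_surjective`**); §2 DEF **`WeilGerms`** (`ext`, the `MulAction`, `coe_smul`), DEF **`red`** (`coe_red`, `red_smul`,
`red_surjective`), `WeilOrbits`, DEF `redI` (`redI_mk`, `redI_surjective`), DEF `redOrbit` (`coe_redOrbit`, `redOrbit_smul`, `redOrbit_surjective`),
DEF `pushOrbit` (`pushOrbit_mk`, `pushOrbit_surjective`), DEF **`orbitToP`** (`orbitToP_mk_single`, `orbitToP_mem`), **`LSum`**, DEF **`lSumToP`**
(`lSumToP_single`, `lSumToP_mem`), DEF `lSumToPw` (`coe_lSumToPw`), DEF **`alphaSum`** (`alphaSum_single`, **`alphaSum_surjective`**),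
**`sum_square_comm`**, **`lSumToPw_surjective`**; §3 the instances `instModuleTSum`, `instModuleLSum` (the product module structures, registered by
name for class resolution), `alphaSum_single_sum_eq_zero`, **`exists_kernel_lift`** («`Ker(α″) → Ker(α)` is surjective»), **`isAlmostCartesian_sum`**
(LEMMA 6.10), `int_isAlmostCartesian_sum`.

NOT here: `X^*(T^K)`, `X^*(L^K)` and the last square (next row, via `of_quotients`); THEOREM 6.1 itself (`P^K → L^K ×_{T^K} S^K`; Layer B, B5-09);
the number-theoretic instance.

## References

* [Milne1999] J. S. Milne, *Lefschetz motives and the Tate conjecture*, Compositio Math. 117 (1999) 45–76 — §6 p. 71 L15–L22 (Lemma 6.10), p. 71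
  L23 – p. 72 L4 (end of the proof of Theorem 6.1), p. 68 L23–L27 (held `paper:doi-10-1023-a-1000776613765` p0027, p0028, p0024); §5 pp. 64–65.

Provenance: lane `lit-hodgefound`, seat `lit-hodgefound-p27` gen 17 (agent `literature-prover-lit-hodgefound-p27-g17-0`), row g17-#4.
-/

set_option autoImplicit false

noncomputable section

namespace Literature.NumberTheory.ComplexMultiplication

/-! ### §0 Two transfer lemmas for almost cartesian squares -/

namespace AlmostCartesian

variable {R : Type*} [CommRing R]
variable {N'' N M'' M T L : Type*} [AddCommGroup N''] [AddCommGroup N] [AddCommGroup M''] [AddCommGroup M] [AddCommGroup T]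
  [AddCommGroup L] [Module R N''] [Module R N] [Module R M''] [Module R M] [Module R T] [Module R L]
variable {α'' : N'' →ₗ[R] M''} {γ'' : N'' →ₗ[R] N} {β'' : M'' →ₗ[R] M} {α : N →ₗ[R] M}

/-- **LEMMA 6.3 (c) as a constructor**: a commutative square with all maps onto in which every element of `Ker α` is the image under the top
map of an element of `Ker α″` is almost cartesian («it suffices to prove that the map `Ker(α″) → Ker(α)` is surjective»).
[cite: Milne1999, §6 p. 67 Lemma 6.3; p. 71 L19–L21 (proof of Lemma 6.10)] -/
theorem IsAlmostCartesian.of_kernel_lift (hc : ∀ x, β'' (α'' x) = α (γ'' x)) (h₁ : Function.Surjective α'')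
    (h₂ : Function.Surjective γ'') (h₃ : Function.Surjective β'') (h₄ : Function.Surjective α)
    (hk : ∀ n, α n = 0 → ∃ x, α'' x = 0 ∧ γ'' x = n) : IsAlmostCartesian α'' γ'' β'' α := by
  refine ⟨hc, h₁, h₂, h₃, h₄, fun m n e => ?_⟩
  obtain ⟨x₀, rfl⟩ := h₁ m
  obtain ⟨x, hx0, hxn⟩ := hk (n - γ'' x₀) (by rw [map_sub, ← hc, e, sub_self])
  exact ⟨x₀ + x, by rw [map_add, hx0, add_zero], by rw [map_add, hxn, add_sub_cancel]⟩

/-- **Almost cartesian squares pass to compatible quotients of the left column**: if `(α″, γ″, β″, α)` is almost cartesian and `q : N″ ↠ T`,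
`q′ : M″ ↠ L`, `γ_T`, `β_L`, `α_T` satisfy `γ_T ∘ q = γ″`, `β_L ∘ q′ = β″`, `α_T ∘ q = q′ ∘ α″`, then `(α_T, γ_T, β_L, α)` is almost cartesian —
the mechanism of «the composite of the maps `Ker(α″) → Ker(α′) → Ker(α)` is surjective, which implies that `Ker(α′) → Ker(α)` is surjective.
Therefore the right hand square is almost Cartesian». [cite: Milne1999, §6 p. 71 L23 – p. 72 L4] -/
theorem IsAlmostCartesian.of_quotients (h : IsAlmostCartesian α'' γ'' β'' α) (q : N'' →ₗ[R] T) (q' : M'' →ₗ[R] L) (γT : T →ₗ[R] N)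
    (βL : L →ₗ[R] M) (αT : T →ₗ[R] L) (hq : Function.Surjective q) (hq' : Function.Surjective q') (hγ : ∀ x, γT (q x) = γ'' x)
    (hβ : ∀ y, βL (q' y) = β'' y) (hα : ∀ x, αT (q x) = q' (α'' x)) : IsAlmostCartesian αT γT βL α := by
  refine ⟨fun t => ?_, fun l => ?_, fun n => ?_, fun m => ?_, h.surjective_right, fun l n e => ?_⟩
  · obtain ⟨x, rfl⟩ := hq t
    rw [hα, hβ, hγ, h.comm]
  · obtain ⟨y, rfl⟩ := hq' l
    obtain ⟨x, rfl⟩ := h.surjective_left y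
    exact ⟨q x, hα x⟩
  · obtain ⟨x, rfl⟩ := h.surjective_top n
    exact ⟨q x, hγ x⟩
  · obtain ⟨y, rfl⟩ := h.surjective_bottom m
    exact ⟨q' y, hβ y⟩
  · obtain ⟨y, rfl⟩ := hq' l
    rw [hβ] at e
    obtain ⟨x, h1, h2⟩ := h.lift y n e
    exact ⟨q x, by rw [hα, h1], by rw [hγ, h2]⟩

end AlmostCartesian

namespace CosetGerm

open Finset BlockOnesMatrix OrbitTorus AlmostCartesian

variable {Γ : Type*} [Group Γ] {ι : Γ} {Γ₀ D : Subgroup Γ}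
variable [Fintype Γ] [DecidableEq Γ] [DecidablePred (· ∈ Γ₀)] [DecidablePred (· ∈ D)]
variable (R : Type*) [CommRing R]

/-! ### §1 CM types on `Γ`, their indicators, their orbits, and `⊕_{Φ∈I} X^*(T^Φ) → X^*(S^K)` -/

variable (h : Setting ι Γ₀ D)

/-- **The CM types on `K`** read on `Hom(K, ℚ^{al}) = Γ`: the `Φ ⊂ Γ` with `x ∈ Φ ⟺ ιx ∉ Φ` (i.e. `Γ = Φ ⊔ ιΦ`) — the lane's notion
`Deligne1982.CMTypesFor` (CM types for a self-map of a finite set, here left multiplication by `ι` on `Γ`), wrapped in a type synonym indexed by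
the `Setting` so that the translation action of `Γ` is an instance. [cite: Milne1999, §6 p. 71 L15 («`I = Γ\{CM-types on K}`»); §2 p. 55] -/
def CMTypes (_h : Setting ι Γ₀ D) : Type _ := Literature.AlgebraicGeometry.Deligne1982.CMTypesFor fun x : Γ => ι * x

namespace CMTypes

omit [Fintype Γ] [DecidableEq Γ] [DecidablePred (· ∈ Γ₀)] [DecidablePred (· ∈ D)] in
/-- [cite: Milne1999, §2 p. 55] -/
theorem ext {Φ Ψ : CMTypes h} (e : Φ.1 = Ψ.1) : Φ = Ψ := Subtype.ext e

omit [Fintype Γ] [DecidableEq Γ] [DecidablePred (· ∈ Γ₀)] [DecidablePred (· ∈ D)] in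
/-- The defining property `x ∈ Φ ⟺ ιx ∉ Φ`. [cite: Milne1999, §2 p. 55] -/
theorem mem_iff (Φ : CMTypes h) (x : Γ) : x ∈ Φ.1 ↔ ι * x ∉ Φ.1 := Φ.2 x

omit [Fintype Γ] [DecidableEq Γ] [DecidablePred (· ∈ Γ₀)] [DecidablePred (· ∈ D)] in
/-- `x ∉ Φ ⟺ ιx ∈ Φ`. [cite: Milne1999, §2 p. 55] -/
theorem not_mem_iff (Φ : CMTypes h) (x : Γ) : x ∉ Φ.1 ↔ ι * x ∈ Φ.1 := by
  have e : ι * x ∈ Φ.1 ↔ ι * (ι * x) ∉ Φ.1 := Φ.2 (ι * x)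
  rw [← mul_assoc, h.mul_self, one_mul] at e
  exact e.symm

omit [DecidablePred (· ∈ Γ₀)] [DecidablePred (· ∈ D)] in
/-- There are finitely many CM types (`Γ` is finite). [cite: Milne1999, §2 p. 55] -/
instance : Fintype (CMTypes h) :=
  inferInstanceAs (Fintype (Literature.AlgebraicGeometry.Deligne1982.CMTypesFor fun x : Γ => ι * x))

omit [Fintype Γ] [DecidablePred (· ∈ Γ₀)] [DecidablePred (· ∈ D)] in
/-- Equality of CM types is decidable (they are finite subsets of `Γ`). [cite: Milne1999, §2 p. 55] -/
instance : DecidableEq (CMTypes h) :=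
  inferInstanceAs (DecidableEq (Literature.AlgebraicGeometry.Deligne1982.CMTypesFor fun x : Γ => ι * x))

omit [Fintype Γ] [DecidablePred (· ∈ Γ₀)] [DecidablePred (· ∈ D)] in
/-- `x ∈ gS ⟺ g⁻¹x ∈ S`. [cite: Milne1999, §6 p. 71 L15] -/
theorem mem_image_mul_iff (S : Finset Γ) (g x : Γ) : x ∈ S.image (g * ·) ↔ g⁻¹ * x ∈ S := by
  simp only [Finset.mem_image]
  constructor
  · rintro ⟨a, ha, rfl⟩
    rwa [inv_mul_cancel_left]
  · intro hx
    exact ⟨g⁻¹ * x, hx, mul_inv_cancel_left g x⟩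

omit [Fintype Γ] [DecidablePred (· ∈ Γ₀)] [DecidablePred (· ∈ D)] in
/-- **`Γ` acts on the CM types by left translation** `Φ ↦ gΦ` (a CM type again since `ι` is central). [cite: Milne1999, §6 p. 71 L15; §2 p. 55
(«`Γ`-orbit of CM-types»)] -/
instance : SMul Γ (CMTypes h) :=
  ⟨fun g Φ => ⟨Φ.1.image (g * ·), fun x => by
    rw [mem_image_mul_iff, mem_image_mul_iff, mem_iff h Φ (g⁻¹ * x)]
    simp only [← mul_assoc, h.comm g⁻¹]⟩⟩

omit [Fintype Γ] [DecidablePred (· ∈ Γ₀)] [DecidablePred (· ∈ D)] in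
/-- [cite: Milne1999, §6 p. 71 L15] -/
theorem coe_smul (g : Γ) (Φ : CMTypes h) : (g • Φ).1 = Φ.1.image (g * ·) := rfl

omit [Fintype Γ] [DecidablePred (· ∈ Γ₀)] [DecidablePred (· ∈ D)] in
/-- `x ∈ gΦ ⟺ g⁻¹x ∈ Φ`. [cite: Milne1999, §6 p. 71 L15] -/
theorem mem_smul_iff (g : Γ) (Φ : CMTypes h) (x : Γ) : x ∈ (g • Φ).1 ↔ g⁻¹ * x ∈ Φ.1 := mem_image_mul_iff _ _ _

omit [Fintype Γ] [DecidablePred (· ∈ Γ₀)] [DecidablePred (· ∈ D)] in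
/-- `Γ` acts on the CM types by left translation, `Φ ↦ gΦ` («`τΦ`», §2). [cite: Milne1999, §2 p. 55; §6 p. 71 L15] -/
instance : MulAction Γ (CMTypes h) where
  one_smul Φ := ext h (Finset.ext fun x => by rw [mem_smul_iff, inv_one, one_mul])
  mul_smul g g' Φ := ext h (Finset.ext fun x => by rw [mem_smul_iff, mem_smul_iff, mem_smul_iff, mul_inv_rev, mul_assoc])

omit [Fintype Γ] [DecidablePred (· ∈ Γ₀)] [DecidablePred (· ∈ D)] in
/-- `ιΦ` is the complement of `Φ`. [cite: Milne1999, §2 p. 55] -/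
theorem mem_iota_smul_iff (Φ : CMTypes h) (x : Γ) : x ∈ (ι • Φ).1 ↔ x ∉ Φ.1 := by
  rw [mem_smul_iff, inv_eq_of_mul_eq_one_right h.mul_self, not_mem_iff]

end CMTypes

open CMTypes

/-- **`𝟙_Φ ∈ ℤ[Γ]`**, the indicator of a CM type (the character it defines in `X^*(S^K) ⊂ ℤ[Γ]`). [cite: Milne1999, §3 p. 59 L3–L5; §6 p. 71 L15] -/
def ind (Φ : CMTypes h) : Γ →₀ R := ∑ x ∈ Φ.1, Finsupp.single x 1

omit [Fintype Γ] [DecidablePred (· ∈ Γ₀)] [DecidablePred (· ∈ D)] in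
/-- [cite: Milne1999, §3 p. 59 L3–L5] -/
theorem ind_apply (Φ : CMTypes h) (x : Γ) : ind R h Φ x = if x ∈ Φ.1 then 1 else 0 := by
  rw [ind, Finsupp.finsetSum_apply]
  simp_rw [Finsupp.single_apply]
  rw [Finset.sum_ite_eq' Φ.1 x]

omit [Fintype Γ] [DecidablePred (· ∈ Γ₀)] [DecidablePred (· ∈ D)] in
/-- `g𝟙_Φ = 𝟙_{gΦ}`. [cite: Milne1999, §6 p. 71 L15] -/
theorem act_ind (g : Γ) (Φ : CMTypes h) : act R g (ind R h Φ) = ind R h (g • Φ) := by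
  ext x
  rw [act_apply, ind_apply, ind_apply]
  by_cases hx : g⁻¹ * x ∈ Φ.1
  · rw [if_pos hx, if_pos ((mem_smul_iff h g Φ x).mpr hx)]
  · rw [if_neg hx, if_neg (fun h' => hx ((mem_smul_iff h g Φ x).mp h'))]

omit [DecidablePred (· ∈ Γ₀)] [DecidablePred (· ∈ D)] in
/-- **`𝟙_Φ + 𝟙_{ιΦ} = s^K`.** [cite: Milne1999, §3 p. 59 L5–L6] -/
theorem ind_add_ind_smul (Φ : CMTypes h) : ind R h Φ + ind R h (ι • Φ) = onesFun R := by
  ext x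
  rw [Finsupp.add_apply, ind_apply, ind_apply, onesFun_apply]
  by_cases hx : x ∈ Φ.1
  · rw [if_pos hx, if_neg (fun h' => (mem_iota_smul_iff h Φ x).mp h' hx), add_zero]
  · rw [if_neg hx, if_pos ((mem_iota_smul_iff h Φ x).mpr hx), zero_add]

omit [Fintype Γ] [DecidablePred (· ∈ Γ₀)] [DecidablePred (· ∈ D)] in
/-- **`𝟙_Φ ∈ X^*(S^K)`.** [cite: Milne1999, §3 p. 59 L3–L5 («CM-types on `K`» as characters of `S^K`)] -/
theorem ind_mem_serreLattice (Φ : CMTypes h) : ind R h Φ ∈ serreLattice ι R := by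
  have e : ∀ γ : Γ, ind R h Φ γ + ind R h Φ (ι * γ) = 1 := fun γ => by
    rw [ind_apply, ind_apply]
    by_cases hγ : γ ∈ Φ.1
    · rw [if_pos hγ, if_neg ((mem_iff h Φ γ).1 hγ), add_zero]
    · rw [if_neg hγ, if_pos ((not_mem_iff h Φ γ).1 hγ), zero_add]
  have e1 := e 1
  rw [mul_one] at e1
  intro γ
  rw [e γ, e1]

/-- **The CM type `Φ₀ = {1} ∪ ι(Γ₀ ∖ {1})` with `𝟙_{Φ₀} = ψ₀`** (so `τΦ₀` has indicator `ψ_τ`: Milne's `Ψ = ΓΦ₀`). [cite: Milne1999, §6 p. 69 L22–L26] -/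
def psiType : CMTypes h :=
  ⟨univ.filter fun x : Γ => x = 1 ∨ (ι * x ≠ 1 ∧ ι * x ∈ Γ₀), fun x => by
    have hιι : ι * (ι * x) = x := by rw [← mul_assoc, h.mul_self, one_mul]
    simp only [mem_filter, mem_univ, true_and, hιι, not_or, not_and]
    by_cases hx : x ∈ Γ₀
    · have hιx : ι * x ∉ Γ₀ := h.mul_not_mem hx
      have hι1 : ι * x ≠ 1 := fun e => h.not_mem (by
        have : ι = x⁻¹ := eq_inv_of_mul_eq_one_left e
        rw [this]; exact Γ₀.inv_mem hx)
      constructor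
      · rintro (rfl | ⟨-, h'⟩)
        · exact ⟨hι1, fun h1 => absurd rfl h1⟩
        · exact absurd h' hιx
      · rintro ⟨-, h'⟩
        by_cases hx1 : x = 1
        · exact Or.inl hx1
        · exact absurd hx (h' hx1)
    · have hιx : ι * x ∈ Γ₀ := h.mul_mem hx
      have hx1 : x ≠ 1 := fun e => hx (e ▸ Γ₀.one_mem)
      constructor
      · rintro (e | ⟨hne, -⟩)
        · exact absurd e hx1
        · exact ⟨hne, fun _ => hx⟩
      · rintro ⟨hne, -⟩
        exact Or.inr ⟨hne, hιx⟩⟩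

omit [DecidablePred (· ∈ D)] in
/-- [cite: Milne1999, §6 p. 69 L22–L26] -/
theorem mem_psiType_iff (x : Γ) : x ∈ (psiType h).1 ↔ x = 1 ∨ (ι * x ≠ 1 ∧ ι * x ∈ Γ₀) := by
  change x ∈ univ.filter _ ↔ _
  rw [mem_filter]
  exact and_iff_right (mem_univ _)

omit [DecidablePred (· ∈ D)] in
/-- **`𝟙_{Φ₀} = ψ₀` (`= ψ_1`).** [cite: Milne1999, §6 p. 69 L22–L26] -/
theorem ind_psiType : ind R h (psiType h) = psi ι Γ₀ R 1 := by
  ext x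
  rw [ind_apply, psi_apply R h]
  simp only [mem_psiType_iff]
  by_cases hx1 : x = 1
  · subst hx1
    have : ¬(ι * 1 ≠ 1 ∧ ι * 1 ∈ Γ₀) := fun hh => h.not_mem (by simpa using hh.2)
    rw [if_pos (Or.inl rfl), if_pos rfl, if_neg this, add_zero]
  · rw [if_neg (Ne.symm hx1), zero_add]
    by_cases hc : ι * x ≠ 1 ∧ ι * x ∈ Γ₀
    · rw [if_pos (Or.inr hc), if_pos hc]
    · rw [if_neg (fun hh => hh.elim hx1 hc), if_neg hc]

omit [DecidablePred (· ∈ D)] in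
/-- **`𝟙_{τΦ₀} = ψ_τ`** for `τ ∈ Γ₀` («`τ_iψ₀ = ψ_i`»). [cite: Milne1999, §6 p. 69 L24–L26] -/
theorem ind_smul_psiType {τ : Γ} (hτ : τ ∈ Γ₀) : ind R h (τ • psiType h) = psi ι Γ₀ R τ := by
  rw [← act_ind, ind_psiType, act_psi R h hτ, mul_one]

/-- **The CM type `ιΓ₀` with indicator `ψ̄`.** [cite: Milne1999, §6 p. 69 L22–L23, p. 70 L23] -/
def barType : CMTypes h :=
  ⟨univ.filter fun x : Γ => x ∉ Γ₀, fun x => by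
    simp only [mem_filter, mem_univ, true_and, not_not]
    exact ⟨fun hx => h.mul_mem hx, fun hιx hx => h.mul_not_mem hx hιx⟩⟩

omit [DecidablePred (· ∈ D)] in
/-- **`𝟙_{ιΓ₀} = ψ̄`.** [cite: Milne1999, §6 p. 69 L22–L23] -/
theorem ind_barType : ind R h (barType h) = psiBar ι Γ₀ R := by
  ext x
  rw [ind_apply, psiBar_apply R h]
  change (if x ∈ univ.filter (fun x : Γ => x ∉ Γ₀) then (1 : R) else 0) = _
  simp only [mem_filter, mem_univ, true_and]
  by_cases hx : x ∈ Γ₀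
  · rw [if_neg (not_not.mpr hx), if_neg (h.mul_not_mem hx)]
  · rw [if_pos hx, if_pos (h.mul_mem hx)]

/-- **`I = Γ\{CM-types on K}`**, the set of `Γ`-orbits of CM types. [cite: Milne1999, §6 p. 71 L15] -/
abbrev CMOrbits : Type _ := MulAction.orbitRel.Quotient Γ (CMTypes h)

/-- `I` is finite. [cite: Milne1999, §6 p. 71 L15] -/
instance : Fintype (CMOrbits h) := Fintype.ofFinite _

/-- (classical) decidable equality on `I`, to index direct sums by it. [cite: Milne1999, §6 p. 71 L15–L16] -/
instance : DecidableEq (CMOrbits h) := Classical.decEq _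

omit [Fintype Γ] [DecidablePred (· ∈ Γ₀)] [DecidablePred (· ∈ D)] in
/-- `gΦ` lies in the orbit class of `Φ`. [cite: Milne1999, §6 p. 71 L15] -/
theorem smul_mem_orbit (g : Γ) (Φ : CMTypes h) :
    g • Φ ∈ MulAction.orbitRel.Quotient.orbit (Quotient.mk'' Φ : CMOrbits h) :=
  MulAction.orbitRel.Quotient.mem_orbit.mpr (Quotient.sound (MulAction.mem_orbit Φ g))

omit [Fintype Γ] [DecidablePred (· ∈ Γ₀)] [DecidablePred (· ∈ D)] in
/-- `Φ` lies in its own orbit class. [cite: Milne1999, §6 p. 71 L15] -/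
theorem self_mem_orbit (Φ : CMTypes h) : Φ ∈ MulAction.orbitRel.Quotient.orbit (Quotient.mk'' Φ : CMOrbits h) :=
  MulAction.orbitRel.Quotient.mem_orbit.mpr rfl

section TSide

variable [NoZeroDivisors R] (h2 : (2 : R) ≠ 0)

/-- **`X^*(T^Φ) → X^*(S^K)` for the orbit class `c ∈ I`**: `X^*(T^c) = ℤ[c]/{f = ιf, Σ f = 0}` (`CharModule R c.orbit ι`) and `[δ_Φ] ↦ 𝟙_Φ`
(«`f ↦ Σ f(ψ)ψ`», g15-#1 `liftChar`, well defined as `𝟙_Φ + 𝟙_{ιΦ} = s^K`). [cite: Milne1999, §3 p. 59 L3–L5; §6 p. 71 L16 (Lemma 6.10, `γ`)] -/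
def orbitToS (c : CMOrbits h) : CharModule R (MulAction.orbitRel.Quotient.orbit c) ι →ₗ[R] (Γ →₀ R) :=
  liftChar R ι (IsRegular.of_ne_zero h2) (fun Φ => ind R h Φ.1) (onesFun R) fun Φ => ind_add_ind_smul R h Φ.1

omit [DecidablePred (· ∈ Γ₀)] [DecidablePred (· ∈ D)] in
/-- `[δ_Φ] ↦ 𝟙_Φ`. [cite: Milne1999, §6 p. 71 L16] -/
theorem orbitToS_mk_single (c : CMOrbits h) (Φ : MulAction.orbitRel.Quotient.orbit c) :
    orbitToS R h h2 c (Submodule.Quotient.mk (Finsupp.single Φ 1)) = ind R h Φ.1 :=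
  liftChar_mk_single R ι _ _ _ _ Φ

omit [DecidablePred (· ∈ Γ₀)] [DecidablePred (· ∈ D)] in
/-- `X^*(T^c) → ℤ[Γ]` lands in `X^*(S^K)`. [cite: Milne1999, §6 p. 71 L16] -/
theorem orbitToS_mem (c : CMOrbits h) (x : CharModule R (MulAction.orbitRel.Quotient.orbit c) ι) :
    orbitToS R h h2 c x ∈ serreLattice ι R := by
  induction x using Submodule.Quotient.induction_on with | H f => ?_
  rw [orbitToS, liftChar_mk, Finsupp.linearCombination_apply, Finsupp.sum]
  exact Submodule.sum_mem _ fun Φ _ => Submodule.smul_mem _ _ (ind_mem_serreLattice R h Φ.1)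

/-- **`⊕_{Φ∈I} X^*(T^Φ)`** (a finite product). [cite: Milne1999, §6 p. 71 L16 (Lemma 6.10)] -/
abbrev TSum : Type _ := (c : CMOrbits h) → CharModule R (MulAction.orbitRel.Quotient.orbit c) ι

/-- **`γ : ⊕_{Φ∈I} X^*(T^Φ) → ℤ[Γ]`**, the sum of the `X^*(T^c) → X^*(S^K)`. [cite: Milne1999, §6 p. 71 L16 (Lemma 6.10)] -/
def tSumToS : TSum R h →ₗ[R] (Γ →₀ R) := ∑ c : CMOrbits h, (orbitToS R h h2 c).comp (LinearMap.proj c)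

omit [DecidablePred (· ∈ Γ₀)] [DecidablePred (· ∈ D)] in
/-- On a single summand. [cite: Milne1999, §6 p. 71 L16] -/
theorem tSumToS_single (c : CMOrbits h) (x : CharModule R (MulAction.orbitRel.Quotient.orbit c) ι) :
    tSumToS R h h2 (Pi.single c x) = orbitToS R h h2 c x := by
  rw [tSumToS, LinearMap.sum_apply]
  simp only [LinearMap.comp_apply, LinearMap.proj_apply]
  rw [Fintype.sum_eq_single c fun c' hc' => by rw [Pi.single_eq_of_ne hc', map_zero], Pi.single_eq_same]

omit [DecidablePred (· ∈ Γ₀)] [DecidablePred (· ∈ D)] in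
/-- `γ` lands in `X^*(S^K)`. [cite: Milne1999, §6 p. 71 L16] -/
theorem tSumToS_mem (x : TSum R h) : tSumToS R h h2 x ∈ serreLattice ι R := by
  rw [tSumToS, LinearMap.sum_apply]
  exact Submodule.sum_mem _ fun c _ => orbitToS_mem R h h2 c (x c)

/-- **`γ : ⊕_{Φ∈I} X^*(T^Φ) → X^*(S^K)`.** [cite: Milne1999, §6 p. 71 L16 (Lemma 6.10)] -/
def tSumToSs : TSum R h →ₗ[R] serreLattice ι R := LinearMap.codRestrict (serreLattice ι R) (tSumToS R h h2) (tSumToS_mem R h h2)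

omit [DecidablePred (· ∈ Γ₀)] [DecidablePred (· ∈ D)] in
/-- [cite: Milne1999, §6 p. 71 L16] -/
@[simp] theorem coe_tSumToSs (x : TSum R h) : (tSumToSs R h h2 x : Γ →₀ R) = tSumToS R h h2 x := rfl

omit [DecidablePred (· ∈ D)] in
/-- `γ[Σ_τ c_τ δ_{τΦ₀}]` (in the summand of `ΓΦ₀`) `= Σ_τ c_τ ψ_τ`. [cite: Milne1999, §6 p. 71 L13–L16] -/
theorem tSumToS_single_sum (a : Γ → R) :
    tSumToS R h h2 (Pi.single (Quotient.mk'' (psiType h) : CMOrbits h)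
      (Submodule.Quotient.mk (∑ τ ∈ univ.filter (· ∈ Γ₀), a τ • Finsupp.single ⟨τ • psiType h, smul_mem_orbit h τ (psiType h)⟩ 1))) =
      ∑ τ ∈ univ.filter (· ∈ Γ₀), a τ • psi ι Γ₀ R τ := by
  rw [tSumToS_single, orbitToS, liftChar_mk, map_sum]
  refine Finset.sum_congr rfl fun τ hτ => ?_
  rw [map_smul, Finsupp.linearCombination_single, one_smul, ind_smul_psiType R h (mem_filter.mp hτ).2]

omit [DecidablePred (· ∈ D)] in
/-- **«all the maps are surjective»: `γ` is onto `X^*(S^K)`** (its image contains `ψ_τ = 𝟙_{τΦ₀}` and `ψ̄ = 𝟙_{ιΓ₀}`, which span `X^*(S^K)` by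
Lemma 3.3). [cite: Milne1999, §6 p. 71 L19–L20 (proof of Lemma 6.10)] -/
theorem tSumToSs_surjective : Function.Surjective (tSumToSs R h h2) := by
  intro s
  refine ⟨Pi.single (Quotient.mk'' (psiType h) : CMOrbits h)
      (Submodule.Quotient.mk (∑ τ ∈ univ.filter (· ∈ Γ₀), (s : Γ →₀ R) τ •
        Finsupp.single ⟨τ • psiType h, smul_mem_orbit h τ (psiType h)⟩ 1)) +
    Pi.single (Quotient.mk'' (barType h) : CMOrbits h)
      (Submodule.Quotient.mk (((s : Γ →₀ R) 1 + (s : Γ →₀ R) ι - ∑ τ ∈ univ.filter (· ∈ Γ₀), (s : Γ →₀ R) τ) •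
        Finsupp.single ⟨barType h, self_mem_orbit h (barType h)⟩ 1)), Subtype.ext ?_⟩
  rw [coe_tSumToSs, map_add, tSumToS_single_sum, tSumToS_single, Submodule.Quotient.mk_smul, map_smul, orbitToS_mk_single,
    ind_barType]
  exact (eq_sum_psi_add_psiBar R h s.2).symm

end TSide

/-! ### §2 `W^K_{1,+}(p^∞)` as the germs `push(𝟙_Φ)`, its orbits `I′`, `⊕_{Π∈I′} X^*(L^Π) → X^*(P^K)`, and `α″` -/

/-- **`W^K_{1,+}(p^∞)` in the model**: the `f_{π(Φ)} = push(𝟙_Φ) ∈ ℤ[Γ/D]`, `Φ` a CM type (every element of `W^K_{1,+}(p^∞)` is a `π(Φ)`, §5;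
`π ↦ f_π` injective, §4). [cite: Milne1999, §6 p. 71 L15 («`I′ = Γ\W^K_{1,+}(p^∞)`»); §5 pp. 64–65] -/
def WeilGerms : Type _ := {w : Γ ⧸ D →₀ R // ∃ Φ : CMTypes h, pushFun R ((↑) : Γ → Γ ⧸ D) (ind R h Φ) = w}

namespace WeilGerms

omit [Fintype Γ] [DecidableEq Γ] [DecidablePred (· ∈ Γ₀)] [DecidablePred (· ∈ D)] in
/-- [cite: Milne1999, §6 p. 71 L15] -/
theorem ext {w w' : WeilGerms R h} (e : w.1 = w'.1) : w = w' := Subtype.ext e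

omit [Fintype Γ] [DecidablePred (· ∈ Γ₀)] [DecidablePred (· ∈ D)] in
/-- `Γ` acts on the germs by translation of `Γ/D` (`gπ(Φ) = π(gΦ)`). [cite: Milne1999, §6 p. 71 L15; §5 pp. 64–65] -/
instance : SMul Γ (WeilGerms R h) :=
  ⟨fun g w => ⟨act R g w.1, by
    obtain ⟨Φ, hΦ⟩ := w.2
    exact ⟨g • Φ, by rw [← act_ind, pushFun_act R ((↑) : Γ → Γ ⧸ D) (g := g) (fun _ => rfl), hΦ]⟩⟩⟩

omit [Fintype Γ] [DecidablePred (· ∈ Γ₀)] [DecidablePred (· ∈ D)] in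
/-- [cite: Milne1999, §6 p. 71 L15] -/
theorem coe_smul (g : Γ) (w : WeilGerms R h) : (g • w).1 = act R g w.1 := rfl

omit [Fintype Γ] [DecidablePred (· ∈ Γ₀)] [DecidablePred (· ∈ D)] in
/-- The translation action of `Γ` on `W^K_{1,+}(p^∞)` (`gπ(Φ) = π(gΦ)`). [cite: Milne1999, §6 p. 71 L15; §5 pp. 64–65] -/
instance : MulAction Γ (WeilGerms R h) where
  one_smul w := ext R h (by rw [coe_smul, act_one, LinearMap.id_apply])
  mul_smul g g' w := ext R h (by rw [coe_smul, coe_smul, coe_smul, act_mul, LinearMap.comp_apply])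

end WeilGerms

/-- **`π : {CM types} → W^K_{1,+}(p^∞)`, `Φ ↦ π(Φ)`** (read through `f`: `Φ ↦ push(𝟙_Φ)`), the reduction on generators. [cite: Milne1999, §5
pp. 64–65; §6 p. 69 L27] -/
def red (Φ : CMTypes h) : WeilGerms R h := ⟨pushFun R ((↑) : Γ → Γ ⧸ D) (ind R h Φ), Φ, rfl⟩

omit [Fintype Γ] [DecidableEq Γ] [DecidablePred (· ∈ Γ₀)] [DecidablePred (· ∈ D)] in
/-- [cite: Milne1999, §5 pp. 64–65] -/
@[simp] theorem coe_red (Φ : CMTypes h) : (red R h Φ).1 = pushFun R ((↑) : Γ → Γ ⧸ D) (ind R h Φ) := rfl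

omit [Fintype Γ] [DecidablePred (· ∈ Γ₀)] [DecidablePred (· ∈ D)] in
/-- `π` is `Γ`-equivariant. [cite: Milne1999, §5 pp. 64–65] -/
theorem red_smul (g : Γ) (Φ : CMTypes h) : red R h (g • Φ) = g • red R h Φ :=
  WeilGerms.ext R h (by rw [coe_red, WeilGerms.coe_smul, coe_red, ← act_ind, pushFun_act R ((↑) : Γ → Γ ⧸ D) (g := g) (fun _ => rfl)])

omit [Fintype Γ] [DecidableEq Γ] [DecidablePred (· ∈ Γ₀)] [DecidablePred (· ∈ D)] in
/-- `π` is onto `W^K_{1,+}(p^∞)` (by definition of the model; in print: §5 «The reduction functor»). [cite: Milne1999, §5 p. 65] -/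
theorem red_surjective : Function.Surjective (red R h) := fun w => by
  obtain ⟨Φ, hΦ⟩ := w.2
  exact ⟨Φ, WeilGerms.ext R h hΦ⟩

/-- `W^K_{1,+}(p^∞)` is finite (a quotient of the finite set of CM types). [cite: Milne1999, §5 p. 65; §6 p. 71 L15] -/
instance : Finite (WeilGerms R h) := Finite.of_surjective _ (red_surjective R h)

/-- **`I′ = Γ\W^K_{1,+}(p^∞)`.** [cite: Milne1999, §6 p. 71 L15] -/
abbrev WeilOrbits : Type _ := MulAction.orbitRel.Quotient Γ (WeilGerms R h)

/-- `I′` is finite. [cite: Milne1999, §6 p. 71 L15] -/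
instance : Fintype (WeilOrbits R h) := Fintype.ofFinite _

/-- (classical) decidable equality on `I′`, to index direct sums by it. [cite: Milne1999, §6 p. 71 L15–L17] -/
instance : DecidableEq (WeilOrbits R h) := Classical.decEq _

/-- `π` on orbit classes, `I → I′` («`Ψ ↦ Π(Ψ)`»). [cite: Milne1999, §5 p. 65; §6 p. 71 L15–L17] -/
def redI : CMOrbits h → WeilOrbits R h :=
  Quotient.map' (red R h) fun a b hab => by
    rw [MulAction.orbitRel_apply, MulAction.mem_orbit_iff] at hab ⊢
    obtain ⟨g, rfl⟩ := hab
    exact ⟨g, (red_smul R h g b).symm⟩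

omit [Fintype Γ] [DecidablePred (· ∈ Γ₀)] [DecidablePred (· ∈ D)] in
/-- [cite: Milne1999, §6 p. 71 L15–L17] -/
theorem redI_mk (Φ : CMTypes h) : redI R h (Quotient.mk'' Φ) = Quotient.mk'' (red R h Φ) := rfl

omit [Fintype Γ] [DecidablePred (· ∈ Γ₀)] [DecidablePred (· ∈ D)] in
/-- `I → I′` is onto. [cite: Milne1999, §6 p. 71 L15–L17] -/
theorem redI_surjective : Function.Surjective (redI R h) := by
  intro c'
  induction c' using Quotient.inductionOn' with | h w => ?_
  obtain ⟨Φ, rfl⟩ := red_surjective R h w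
  exact ⟨Quotient.mk'' Φ, rfl⟩

/-- `π` restricted to an orbit class: `c.orbit → (π c).orbit`. [cite: Milne1999, §5 p. 65; §6 p. 71 L15–L17] -/
def redOrbit (c : CMOrbits h) : MulAction.orbitRel.Quotient.orbit c → MulAction.orbitRel.Quotient.orbit (redI R h c) :=
  fun Φ => ⟨red R h Φ.1, by
    have hΦ := MulAction.orbitRel.Quotient.mem_orbit.mp Φ.2
    refine MulAction.orbitRel.Quotient.mem_orbit.mpr ?_
    conv_rhs => rw [← hΦ]
    rfl⟩

omit [Fintype Γ] [DecidablePred (· ∈ Γ₀)] [DecidablePred (· ∈ D)] in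
/-- [cite: Milne1999, §6 p. 71 L15–L17] -/
@[simp] theorem coe_redOrbit (c : CMOrbits h) (Φ : MulAction.orbitRel.Quotient.orbit c) : (redOrbit R h c Φ).1 = red R h Φ.1 := rfl

omit [Fintype Γ] [DecidablePred (· ∈ Γ₀)] [DecidablePred (· ∈ D)] in
/-- `π` on an orbit is equivariant. [cite: Milne1999, §5 p. 65] -/
theorem redOrbit_smul (c : CMOrbits h) (g : Γ) (Φ : MulAction.orbitRel.Quotient.orbit c) :
    redOrbit R h c (g • Φ) = g • redOrbit R h c Φ :=
  Subtype.ext (by rw [coe_redOrbit, MulAction.orbitRel.Quotient.orbit.coe_smul, red_smul, MulAction.orbitRel.Quotient.orbit.coe_smul,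
    coe_redOrbit])

omit [Fintype Γ] [DecidablePred (· ∈ Γ₀)] [DecidablePred (· ∈ D)] in
/-- `π` maps each orbit onto the image orbit. [cite: Milne1999, §5 p. 65] -/
theorem redOrbit_surjective (c : CMOrbits h) : Function.Surjective (redOrbit R h c) := by
  rintro ⟨w, hw⟩
  induction c using Quotient.inductionOn' with | h Φ₀ => ?_
  rw [MulAction.orbitRel.Quotient.mem_orbit, redI_mk, Quotient.eq''] at hw
  change w ∈ MulAction.orbit Γ (red R h Φ₀) at hw
  obtain ⟨g, rfl⟩ := MulAction.mem_orbit_iff.mp hw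
  exact ⟨⟨g • Φ₀, smul_mem_orbit h g Φ₀⟩, Subtype.ext (by rw [coe_redOrbit, red_smul])⟩

/-- **`X^*(α′)` on one summand: the push `X^*(T^c) → X^*(L^{π(c)})` along `Φ ↦ π(Φ)`** (g16-#6 `OrbitTorus.push`). [cite: Milne1999, §5 p. 65;
§6 p. 71 L16–L17 (`α″`)] -/
def pushOrbit (c : CMOrbits h) :
    CharModule R (MulAction.orbitRel.Quotient.orbit c) ι →ₗ[R] CharModule R (MulAction.orbitRel.Quotient.orbit (redI R h c)) ι :=
  push R ι (redOrbit R h c) fun Φ => redOrbit_smul R h c ι Φ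

omit [Fintype Γ] [DecidablePred (· ∈ Γ₀)] [DecidablePred (· ∈ D)] in
/-- [cite: Milne1999, §6 p. 71 L16–L17] -/
theorem pushOrbit_mk (c : CMOrbits h) (f : MulAction.orbitRel.Quotient.orbit c →₀ R) :
    pushOrbit R h c (Submodule.Quotient.mk f) = Submodule.Quotient.mk (pushFun R (redOrbit R h c) f) := rfl

omit [Fintype Γ] [DecidablePred (· ∈ Γ₀)] [DecidablePred (· ∈ D)] in
/-- `X^*(α′)` is onto on each summand. [cite: Milne1999, §5 p. 65 («induces a surjective homomorphism»)] -/
theorem pushOrbit_surjective (c : CMOrbits h) : Function.Surjective (pushOrbit R h c) :=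
  push_surjective R ι _ _ (redOrbit_surjective R h c)

section LSide

variable [NoZeroDivisors R] (h2 : (2 : R) ≠ 0)

/-- **`X^*(L^Π) → X^*(P^K) ↪ ℤ[Γ/D]` for the orbit class `c′ ∈ I′`**, `[δ_π] ↦ f_π` (well defined as `f_π + f_{ιπ} = push(s^K)`). [cite: Milne1999,
§6 p. 71 L17 (Lemma 6.10, `β`); §4] -/
def orbitToP (c' : WeilOrbits R h) : CharModule R (MulAction.orbitRel.Quotient.orbit c') ι →ₗ[R] (Γ ⧸ D →₀ R) :=
  liftChar R ι (IsRegular.of_ne_zero h2) (fun w => w.1.1) (pushFun R ((↑) : Γ → Γ ⧸ D) (onesFun R)) fun w => by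
    obtain ⟨Φ, hΦ⟩ := w.1.2
    change w.1.1 + act R ι w.1.1 = _
    rw [← hΦ, ← pushFun_act R ((↑) : Γ → Γ ⧸ D) (g := ι) (fun _ => rfl), ← map_add, act_ind, ind_add_ind_smul]

omit [DecidablePred (· ∈ Γ₀)] [DecidablePred (· ∈ D)] in
/-- `[δ_π] ↦ f_π`. [cite: Milne1999, §6 p. 71 L17] -/
theorem orbitToP_mk_single (c' : WeilOrbits R h) (w : MulAction.orbitRel.Quotient.orbit c') :
    orbitToP R h h2 c' (Submodule.Quotient.mk (Finsupp.single w 1)) = w.1.1 :=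
  liftChar_mk_single R ι _ _ _ _ w

omit [DecidablePred (· ∈ Γ₀)] [DecidablePred (· ∈ D)] in
/-- `X^*(L^{c′}) → ℤ[Γ/D]` lands in `X^*(P^K)`. [cite: Milne1999, §6 p. 71 L17] -/
theorem orbitToP_mem (c' : WeilOrbits R h) (y : CharModule R (MulAction.orbitRel.Quotient.orbit c') ι) :
    orbitToP R h h2 c' y ∈ weilLattice ι D R := by
  induction y using Submodule.Quotient.induction_on with | H f => ?_
  rw [orbitToP, liftChar_mk, Finsupp.linearCombination_apply, Finsupp.sum]
  refine Submodule.sum_mem _ fun w _ => Submodule.smul_mem _ _ ?_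
  obtain ⟨Φ, hΦ⟩ := w.1.2
  exact LinearMap.mem_range.mpr ⟨⟨ind R h Φ, ind_mem_serreLattice R h Φ⟩, hΦ⟩

/-- **`⊕_{Π∈I′} X^*(L^Π)`.** [cite: Milne1999, §6 p. 71 L17 (Lemma 6.10)] -/
abbrev LSum : Type _ := (c' : WeilOrbits R h) → CharModule R (MulAction.orbitRel.Quotient.orbit c') ι

/-- **`β : ⊕_{Π∈I′} X^*(L^Π) → ℤ[Γ/D]`.** [cite: Milne1999, §6 p. 71 L17 (Lemma 6.10)] -/
def lSumToP : LSum R h →ₗ[R] (Γ ⧸ D →₀ R) := ∑ c' : WeilOrbits R h, (orbitToP R h h2 c').comp (LinearMap.proj c')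

omit [DecidablePred (· ∈ Γ₀)] [DecidablePred (· ∈ D)] in
/-- On a single summand. [cite: Milne1999, §6 p. 71 L17] -/
theorem lSumToP_single (c' : WeilOrbits R h) (y : CharModule R (MulAction.orbitRel.Quotient.orbit c') ι) :
    lSumToP R h h2 (Pi.single c' y) = orbitToP R h h2 c' y := by
  rw [lSumToP, LinearMap.sum_apply]
  simp only [LinearMap.comp_apply, LinearMap.proj_apply]
  rw [Fintype.sum_eq_single c' fun c'' hc'' => by rw [Pi.single_eq_of_ne hc'', map_zero], Pi.single_eq_same]

omit [DecidablePred (· ∈ Γ₀)] [DecidablePred (· ∈ D)] in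
/-- `β` lands in `X^*(P^K)`. [cite: Milne1999, §6 p. 71 L17] -/
theorem lSumToP_mem (y : LSum R h) : lSumToP R h h2 y ∈ weilLattice ι D R := by
  rw [lSumToP, LinearMap.sum_apply]
  exact Submodule.sum_mem _ fun c' _ => orbitToP_mem R h h2 c' (y c')

/-- **`β : ⊕_{Π∈I′} X^*(L^Π) → X^*(P^K)`.** [cite: Milne1999, §6 p. 71 L17 (Lemma 6.10)] -/
def lSumToPw : LSum R h →ₗ[R] weilLattice ι D R := LinearMap.codRestrict (weilLattice ι D R) (lSumToP R h h2) (lSumToP_mem R h h2)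

omit [DecidablePred (· ∈ Γ₀)] [DecidablePred (· ∈ D)] in
/-- [cite: Milne1999, §6 p. 71 L17] -/
@[simp] theorem coe_lSumToPw (y : LSum R h) : (lSumToPw R h h2 y : Γ ⧸ D →₀ R) = lSumToP R h h2 y := rfl

/-- **`α″ : ⊕_{Φ∈I} X^*(T^Φ) → ⊕_{Π∈I′} X^*(L^Π)`**: on the summand of `c` the push to the summand of `π(c)`. [cite: Milne1999, §6 p. 71 L16–L17
(Lemma 6.10, `α″`)] -/
def alphaSum : TSum R h →ₗ[R] LSum R h :=
  ∑ c : CMOrbits h, (LinearMap.single R (fun c' : WeilOrbits R h => CharModule R (MulAction.orbitRel.Quotient.orbit c') ι) (redI R h c)).comp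
    ((pushOrbit R h c).comp (LinearMap.proj c))

omit [DecidablePred (· ∈ Γ₀)] [DecidablePred (· ∈ D)] [NoZeroDivisors R] in
/-- On a single summand. [cite: Milne1999, §6 p. 71 L16–L17] -/
theorem alphaSum_single (c : CMOrbits h) (x : CharModule R (MulAction.orbitRel.Quotient.orbit c) ι) :
    alphaSum R h (Pi.single c x) = Pi.single (redI R h c) (pushOrbit R h c x) := by
  rw [alphaSum, LinearMap.sum_apply]
  simp only [LinearMap.comp_apply, LinearMap.proj_apply, LinearMap.coe_single]
  rw [Fintype.sum_eq_single c fun c'' hc'' => by rw [Pi.single_eq_of_ne hc'', map_zero, Pi.single_zero], Pi.single_eq_same]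

omit [DecidablePred (· ∈ Γ₀)] [DecidablePred (· ∈ D)] [NoZeroDivisors R] in
/-- **«all the maps are surjective»: `α″` is onto** (each push is onto and `I → I′` is onto). [cite: Milne1999, §6 p. 71 L19 (proof of Lemma 6.10)] -/
theorem alphaSum_surjective : Function.Surjective (alphaSum R h) := by
  have single_mem : ∀ (c' : WeilOrbits R h) (z : CharModule R (MulAction.orbitRel.Quotient.orbit c') ι),
      Pi.single c' z ∈ LinearMap.range (alphaSum R h) := by
    intro c' z
    obtain ⟨c, rfl⟩ := redI_surjective R h c'
    obtain ⟨x, rfl⟩ := pushOrbit_surjective R h c z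
    exact ⟨Pi.single c x, alphaSum_single R h c x⟩
  rw [← LinearMap.range_eq_top, eq_top_iff]
  intro y _
  rw [← LinearMap.sum_single_apply _ y]
  exact Submodule.sum_mem _ fun c' _ => single_mem c' (y c')

omit [DecidablePred (· ∈ Γ₀)] [DecidablePred (· ∈ D)] in
/-- **The square of Lemma 6.10 commutes** (Lemma 5.1's diagram summand by summand: `push(𝟙_Φ) = f_{π(Φ)}`). [cite: Milne1999, §6 p. 71 L16–L17;
§5 Lemma 5.1] -/
theorem sum_square_comm (x : TSum R h) : alphaP ι D R (tSumToSs R h h2 x) = lSumToPw R h h2 (alphaSum R h x) := by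
  apply Subtype.ext
  rw [coe_alphaP, coe_tSumToSs, coe_lSumToPw]
  revert x
  rw [← funext_iff]
  change ⇑((pushFun R ((↑) : Γ → Γ ⧸ D)).comp (tSumToS R h h2)) = ⇑((lSumToP R h h2).comp (alphaSum R h))
  refine congrArg _ (LinearMap.pi_ext fun c x => ?_)
  rw [LinearMap.comp_apply, LinearMap.comp_apply, tSumToS_single, alphaSum_single, lSumToP_single]
  induction x using Submodule.Quotient.induction_on with | H f => ?_
  induction f using Finsupp.induction_linear with
  | zero => rw [Submodule.Quotient.mk_zero, map_zero, map_zero, map_zero, map_zero]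
  | add f₁ f₂ h₁ h₂ => rw [Submodule.Quotient.mk_add, map_add, map_add, map_add, map_add, h₁, h₂]
  | single Φ r =>
    rw [← Finsupp.smul_single_one, Submodule.Quotient.mk_smul, map_smul, map_smul, map_smul, map_smul, orbitToS_mk_single, pushOrbit_mk,
      pushFun_single, orbitToP_mk_single, coe_redOrbit, coe_red]

omit [DecidablePred (· ∈ D)] in
/-- **«Since the maps are all surjective»: `β` is onto `X^*(P^K)`.** [cite: Milne1999, §6 p. 71 L19 (proof of Lemma 6.10)] -/
theorem lSumToPw_surjective : Function.Surjective (lSumToPw R h h2) := by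
  intro y
  obtain ⟨s, rfl⟩ := alphaP_surjective (ι := ι) (D := D) R y
  obtain ⟨x, rfl⟩ := tSumToSs_surjective R h h2 s
  exact ⟨alphaSum R h x, (sum_square_comm R h h2 x).symm⟩

/-! ### §3 LEMMA 6.10 -/

/-- The `R`-module structure of `⊕_{Φ∈I} X^*(T^Φ)`, registered by name: class resolution cannot produce `Module R (Π c, X^*(T^c))` over the
`AddCommGroup`-derived additive structure demanded by `IsAlmostCartesian` (the generic `Pi.module` pattern does not unify with it), so it is
recorded here once and for all. [cite: Milne1999, §6 p. 71 L16 (Lemma 6.10)] -/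
instance instModuleTSum : Module R (TSum R h) := Pi.module _ _ _

/-- The `R`-module structure of `⊕_{Π∈I′} X^*(L^Π)` (see `instModuleTSum`). [cite: Milne1999, §6 p. 71 L17 (Lemma 6.10)] -/
instance instModuleLSum : Module R (LSum R h) := Pi.module _ _ _

omit [NoZeroDivisors R] in
/-- The lift used for Lemma 6.10 is killed by `α″`: for `τ, τ′ ∈ Γ₀` in the same coset of `D`, `π(τΦ₀) = π(τ′Φ₀)` (`push(ψ_τ)` depends only on
`τD`), so `α″[Σ_τ a_τδ_{τΦ₀}] = [Σ_i (Σ_{τ_j∈σ_i} a_j) δ_{π_i}]`, which vanishes when the block sums do. [cite: Milne1999, §6 p. 71 L13–L21] -/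
theorem alphaSum_single_sum_eq_zero (a : Γ → R)
    (hA : ∀ τ ∈ Γ₀, ∑ δ ∈ univ.filter (fun g : Γ => (g : Γ ⧸ D) = (τ : Γ ⧸ D)), a δ = 0) :
    alphaSum R h (Pi.single (Quotient.mk'' (psiType h) : CMOrbits h)
      (Submodule.Quotient.mk (∑ τ ∈ univ.filter (· ∈ Γ₀), a τ • Finsupp.single ⟨τ • psiType h, smul_mem_orbit h τ (psiType h)⟩ 1))) = 0 := by
  rw [alphaSum_single, pushOrbit_mk, map_sum]
  simp_rw [map_smul, pushFun_single]
  -- group the sum by cosets of `D` in `Γ₀`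
  rw [← Finset.sum_fiberwise_of_maps_to (s := univ.filter (· ∈ Γ₀)) (t := halfCosets Γ₀ D) (g := ((↑) : Γ → Γ ⧸ D))
    fun τ hτ => mem_image_of_mem _ hτ]
  rw [Finset.sum_eq_zero fun k hk => ?_, Submodule.Quotient.mk_zero, Pi.single_zero]
  obtain ⟨τ₁, hτ₁, rfl⟩ := exists_rep_of_mem_halfCosets hk
  have hw : ∀ τ ∈ (univ.filter (· ∈ Γ₀)).filter (fun g : Γ => (g : Γ ⧸ D) = (τ₁ : Γ ⧸ D)),
      redOrbit R h (Quotient.mk'' (psiType h)) ⟨τ • psiType h, smul_mem_orbit h τ (psiType h)⟩ =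
        redOrbit R h (Quotient.mk'' (psiType h)) ⟨τ₁ • psiType h, smul_mem_orbit h τ₁ (psiType h)⟩ := by
    intro τ hτ
    obtain ⟨hτ0, hτk⟩ := mem_filter.mp hτ
    have hτΓ₀ : τ ∈ Γ₀ := (mem_filter.mp hτ0).2
    apply Subtype.ext
    apply WeilGerms.ext R h
    rw [coe_redOrbit, coe_redOrbit, coe_red, coe_red, ind_smul_psiType R h hτΓ₀, ind_smul_psiType R h hτ₁, pushFun_psi R h hτΓ₀,
      pushFun_psi R h hτ₁, hτk]
  rw [Finset.sum_congr rfl fun τ hτ => by rw [hw τ hτ], ← Finset.sum_smul, filter_filter_coe_eq h.le hτ₁, hA τ₁ hτ₁, zero_smul]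

/-- **«The map `Ker(α″) → Ker(α)` is surjective»** (the content of Lemma 6.10): an `f ∈ X^*(S^K)` killed by `X^*(α)` has `a = 0` and
vanishing block sums (g17-#3 `alphaS_eq_zero_iff`), hence equals `γ[Σ a_iδ_{τ_iΦ₀}]` with `α″[Σ a_iδ_{τ_iΦ₀}] = 0`. [cite: Milne1999, §6 p. 71
L19–L21 (proof of Lemma 6.10)] -/
theorem exists_kernel_lift (hd : (Fintype.card D : R) ≠ 0) (s : serreLattice ι R) (hs : alphaP ι D R s = 0) :
    ∃ x : TSum R h, alphaSum R h x = 0 ∧ tSumToSs R h h2 x = s := by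
  have hs0 : pushFun R ((↑) : Γ → Γ ⧸ D) (s : Γ →₀ R) = 0 := by
    rw [← coe_alphaP, hs, Submodule.coe_zero]
  obtain ⟨hA, hc⟩ := (alphaS_eq_zero_iff R h hd s.2).mp hs0
  have hsum : ∑ τ ∈ univ.filter (· ∈ Γ₀), (s : Γ →₀ R) τ = 0 := by
    rw [← Finset.sum_fiberwise_of_maps_to (s := univ.filter (· ∈ Γ₀)) (t := halfCosets Γ₀ D) (g := ((↑) : Γ → Γ ⧸ D))
      fun τ hτ => mem_image_of_mem _ hτ]
    exact Finset.sum_eq_zero fun k hk => by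
      obtain ⟨τ, hτ, rfl⟩ := exists_rep_of_mem_halfCosets hk
      rw [filter_filter_coe_eq h.le hτ]
      exact hA τ hτ
  -- (the two components are discharged as separate goals: elaborating the kernel identity inside the anonymous constructor makes the
  -- unifier compare the two copies of the witness instance by instance, which is prohibitively slow)
  refine ⟨Pi.single (Quotient.mk'' (psiType h) : CMOrbits h)
      (Submodule.Quotient.mk (∑ τ ∈ univ.filter (· ∈ Γ₀), (s : Γ →₀ R) τ •
        Finsupp.single ⟨τ • psiType h, smul_mem_orbit h τ (psiType h)⟩ 1)), ?_, ?_⟩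
  · exact alphaSum_single_sum_eq_zero R h (fun τ => (s : Γ →₀ R) τ) hA
  · apply Subtype.ext
    rw [coe_tSumToSs, tSumToS_single_sum]
    conv_rhs => rw [eq_sum_psi_add_psiBar R h s.2, hc, hsum, sub_zero, zero_smul, add_zero]

/-- **LEMMA 6.10: the square `⊕_{Φ∈I} X^*(T^Φ) → X^*(S^K)` over `⊕_{Π∈I′} X^*(L^Π) → X^*(P^K)` is almost cartesian** (for `2 ≠ 0`, `d ≠ 0` in
`R`) — «it suffices to prove that the map `Ker(α″) → Ker(α)` is surjective, but this is obvious from the previous lemma».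
[cite: Milne1999, §6 p. 71 Lemma 6.10] -/
theorem isAlmostCartesian_sum (hd : (Fintype.card D : R) ≠ 0) :
    IsAlmostCartesian (R := R) (N' := TSum R h) (N := ↥(serreLattice ι R)) (M' := LSum R h) (M := ↥(weilLattice ι D R))
      (alphaSum R h) (tSumToSs R h h2) (lSumToPw R h h2) (alphaP ι D R) :=
  IsAlmostCartesian.of_kernel_lift (fun x => (sum_square_comm R h h2 x).symm) (alphaSum_surjective R h)
    (tSumToSs_surjective R h h2) (lSumToPw_surjective R h h2) (alphaP_surjective (ι := ι) (D := D) R) (exists_kernel_lift R h h2 hd)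

omit h2 in
/-- **LEMMA 6.10 over `ℤ`.** [cite: Milne1999, §6 p. 71 Lemma 6.10] -/
theorem int_isAlmostCartesian_sum :
    IsAlmostCartesian (R := ℤ) (N' := TSum ℤ h) (N := ↥(serreLattice ι ℤ)) (M' := LSum ℤ h) (M := ↥(weilLattice ι D ℤ))
      (alphaSum ℤ h) (tSumToSs ℤ h two_ne_zero) (lSumToPw ℤ h two_ne_zero) (alphaP ι D ℤ) :=
  isAlmostCartesian_sum ℤ h two_ne_zero (by exact_mod_cast Fintype.card_ne_zero)

end LSide

end CosetGerm

end Literature.NumberTheory.ComplexMultiplication
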